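import Summits.ValiantsHypothesis.ValiantsHypothesis.Theorems.DepthWindowHomCop
import HarnessLib

/-!
# Bounded-fan-in blocks homogenise at the same product depth (Strassen / Raz)

Kernel companion to the `HomRel` family of route `DepthWindow` (crux item `HomSubReach`,
`Theorems/DepthWindowHomRel.lean`).  `HomRel k j` asks for an every-gate-weighted-homogeneous
version, of relative product-depth `j`, of an arbitrary block of relative product-depth `k`,
outputting all weighted components up to the truncation `d` of all its gates, at size
`poly · 2^{O(d²)}`.  This file proves the classical half of the picture in the tree's gate-list
model: **if every product gate of the block has fan-in `≤ F`, the block homogenises at slope 1**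
— same product depth, every gate weighted homogeneous, size `≤ |Φ|·(d+1)·((F+1)^d + 1)`
(`exists_hom_block_of_fanIn`, `homRel_shape_of_fanIn`).  The construction is Strassen's
component-wise expansion: a sum gate is replaced by `d + 1` sum gates (one per component), a
product gate `∏_{l<t} u_l` by, for each `e ≤ d`, one product gate per weak composition
`f` of `e` into `t` parts (`∏_l (u_l)_{f l}`, `≤ (t+1)^e` of them, `DepthWindowHomComponents`)
and one collecting sum gate; no new product LAYER is created, so every depth entry of the new
list is dominated by one of the old list.  For `F + 1 ≤ 2^d` the size is within the `HomRel`
budget (`pow_fanIn_le`).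

Consequence for the crux: the open content of `HomRel k j` (hence of `HomSubReach`) is exactly
blocks containing product gates of fan-in `≥ 2^d` — in the route's regime `d = ⌊√(log₂ m)⌋`,
fan-in `≥ 2^{√log m}` — where slope 1 fails (`HomRel 1 1` is false, Nisan–Wigderson 1996) and
the Newton-identity scheme of Limaye–Srinivasan–Tavenas gives slope 2.

Main definitions: `cop` (component operand), `sumBlock`, `prodP` / `prodS` / `prodBlocks` /
`prodOut` (the per-component product construction), `Gate.depthAgainst`.  Main statements:
`gateValues_layer`, `gateWDepths_append_block` (block-append bookkeeping, reusable by the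
`HomRelStacks` prover), `prodBlocks_spec`, `exists_hom_block_of_fanIn`, `homRel_shape_of_fanIn`.

[cite: Strassen1973, §3] [cite: Raz2013, §2] [cite: LimayeSrinivasanTavenas2025, Lemma 11, Lemma 19, Lemma 20]
[cite: NisanWigderson1996, Thm. 1] [cite: Burgisser2000, Def. 2.1]
-/

set_option linter.dupNamespace false

namespace Summit.ValiantsHypothesis.ValiantsHypothesis.Theorems.DepthWindow

open MvPolynomial Literature.Computability.AlgebraicComplexity ArithCircuit
open Literature.Computability.AlgebraicComplexity.DepthReduction

variable {k : Type*} [CommSemiring k] {τ : Type*}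

section ProdSpec

variable {w : τ → ℕ} {n d : ℕ} {out₀ : ℕ → ℕ → Operand k τ} {us : List (Operand k τ)}

/-- **Invariant of the product-gate construction** after components `0, …, m-1`: all values
weighted homogeneous, all new depth entries at most the product gate's entry, and the collecting
gate of each treated component `e` holds the weight-`e` component of the product gate's value.
[cite: Strassen1973, §3] -/
theorem prodBlocks_spec (Ψ₀ : List (Gate k τ)) (vals : List (MvPolynomial τ k)) (ds : List ℕ)
    (hvals : vals.length = n)
    (hhom₀ : ∀ g ∈ gateValues Ψ₀, ∃ e : ℕ, IsWeightedHomogeneous w g e)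
    (hrefs : ∀ j e, j < n → e ≤ d → (out₀ j e).RefsBelow Ψ₀.length)
    (hev : ∀ j e, j < n → e ≤ d →
      (out₀ j e).eval (gateValues Ψ₀) = weightedHomogeneousComponent w e (vals.getD j 0))
    (hdp : ∀ j e, j < n → e ≤ d →
      (out₀ j e).depthIn (gateWDepths prodWeight Ψ₀) ≤ ds.getD j 0) :
    ∀ m : ℕ, m ≤ d + 1 →
      (∀ g ∈ gateValues (prodBlocks w n out₀ us Ψ₀ m), ∃ e : ℕ, IsWeightedHomogeneous w g e) ∧
      (∀ x ∈ gateWDepths prodWeight (prodBlocks w n out₀ us Ψ₀ m),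
        x ∈ gateWDepths prodWeight Ψ₀ ∨ x ≤ Gate.depthAgainst prodWeight ds (Gate.prod us)) ∧
      ∀ e < m, prodOut w n out₀ us Ψ₀ e < (prodBlocks w n out₀ us Ψ₀ m).length ∧
        (gateValues (prodBlocks w n out₀ us Ψ₀ m)).getD (prodOut w n out₀ us Ψ₀ e) 0 =
          weightedHomogeneousComponent w e ((Gate.prod us).eval vals) ∧
        (gateWDepths prodWeight (prodBlocks w n out₀ us Ψ₀ m)).getD (prodOut w n out₀ us Ψ₀ e) 0 ≤
          Gate.depthAgainst prodWeight ds (Gate.prod us)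
  | 0, _ => ⟨fun g hg => hhom₀ g hg, fun x hx => Or.inl hx, fun e he => absurd he (Nat.not_lt_zero e)⟩
  | m + 1, hm => by
      obtain ⟨ihhom, ihdep, ihout⟩ :=
        prodBlocks_spec Ψ₀ vals ds hvals hhom₀ hrefs hev hdp m (by omega)
      have hm' : m ≤ d := by omega
      rw [prodBlocks_succ]
      set Ψ := prodBlocks w n out₀ us Ψ₀ m with hΨ
      set P := prodP w n out₀ us m with hP
      set δ := Gate.depthAgainst prodWeight ds (Gate.prod us) with hδ
      -- prefix structure
      obtain ⟨Y, hY⟩ := prodBlocks_prefix w n out₀ us Ψ₀ m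
      rw [← hΨ] at hY
      obtain ⟨XV, hXV, -⟩ := gateValues_prefix Ψ₀ Y
      obtain ⟨XD, hXD, -⟩ := gateWDepths_prefix prodWeight Ψ₀ Y
      have hVΨ : gateValues Ψ = gateValues Ψ₀ ++ XV := by rw [hY, hXV]
      have hDΨ : gateWDepths prodWeight Ψ = gateWDepths prodWeight Ψ₀ ++ XD := by rw [hY, hXD]
      have hlenΨ : Ψ₀.length ≤ Ψ.length := by rw [hY, List.length_append]; omega
      have hVlen : (gateValues Ψ).length = Ψ.length := gateValues_length Ψ
      have hDlen : (gateWDepths prodWeight Ψ).length = Ψ.length := gateWDepths_length prodWeight Ψ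
      have hV₀len : (gateValues Ψ₀).length = Ψ₀.length := gateValues_length Ψ₀
      have hD₀len : (gateWDepths prodWeight Ψ₀).length = Ψ₀.length :=
        gateWDepths_length prodWeight Ψ₀
      have hrefsV : ∀ j e, j < n → e ≤ d → (out₀ j e).RefsBelow (gateValues Ψ₀).length :=
        fun j e hj he => hV₀len ▸ hrefs j e hj he
      have hrefsD : ∀ j e, j < n → e ≤ d →
          (out₀ j e).RefsBelow (gateWDepths prodWeight Ψ₀).length :=
        fun j e hj he => hD₀len ▸ hrefs j e hj he
      have hPbelow : ∀ G ∈ P, ∀ u ∈ G.args, u.RefsBelow Ψ.length := fun G hG u hu =>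
        Operand.refsBelow_mono hlenΨ (prodP_argsBelow hrefs hm' G hG u hu)
      -- values of the new product gates
      obtain ⟨Pv, hPv⟩ : ∃ Pv : List (MvPolynomial τ k),
          Pv = P.map (fun G => G.eval (gateValues Ψ₀ ++ XV)) := ⟨_, rfl⟩
      have hGV1 : gateValues (Ψ ++ P) = gateValues Ψ ++ Pv := by
        rw [gateValues_layer Ψ P hPbelow, hPv, hVΨ]
      have hPv_len : Pv.length = P.length := by rw [hPv, List.length_map]
      have hPv_sum : Pv.sum = weightedHomogeneousComponent w m ((Gate.prod us).eval vals) := by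
        rw [hPv]; exact sum_map_eval_prodP (gateValues Ψ₀) XV vals hvals hrefsV hev hm'
      have hPv_hom : ∀ g ∈ Pv, IsWeightedHomogeneous w g m := by
        rw [hPv]
        intro g hg
        rw [List.mem_map] at hg
        obtain ⟨G, hG, rfl⟩ := hg
        rw [hP, prodP, List.mem_map] at hG
        obtain ⟨f, hf, rfl⟩ := hG
        rw [eval_prodP_gate (gateValues Ψ₀) XV vals hvals hrefsV hev hm' hf]
        exact isWeightedHomogeneous_prod_components w _ hf
      have hSval : (prodS w n out₀ us Ψ.length m).eval (gateValues Ψ ++ Pv) =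
          weightedHomogeneousComponent w m ((Gate.prod us).eval vals) := by
        rw [eval_prodS (gateValues Ψ) Pv hVlen.symm hPv_len, hPv_sum]
      have hGV : gateValues (Ψ ++ (P ++ [prodS w n out₀ us Ψ.length m])) =
          gateValues Ψ ++ (Pv ++ [weightedHomogeneousComponent w m ((Gate.prod us).eval vals)]) := by
        rw [← List.append_assoc, gateValues_append_singleton, hGV1, hSval, List.append_assoc]
      -- depths of the new gates
      obtain ⟨Pd, hPd⟩ : ∃ Pd : List ℕ,
          Pd = P.map (Gate.depthAgainst prodWeight (gateWDepths prodWeight Ψ)) := ⟨_, rfl⟩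
      have hGD1 : gateWDepths prodWeight (Ψ ++ P) = gateWDepths prodWeight Ψ ++ Pd := by
        rw [gateWDepths_append_block prodWeight Ψ P hPbelow, hPd]
      have hPd_len : Pd.length = P.length := by rw [hPd, List.length_map]
      have hPd_le : ∀ x ∈ Pd, x ≤ δ := by
        rw [hPd, hDΨ]
        intro x hx
        rw [List.mem_map] at hx
        obtain ⟨G, hG, rfl⟩ := hx
        exact depthAgainst_prodP_le (gateWDepths prodWeight Ψ₀) XD ds hrefsD hdp hm' G hG
      have hSd : Gate.depthAgainst prodWeight (gateWDepths prodWeight Ψ ++ Pd)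
          (prodS w n out₀ us Ψ.length m) ≤ δ :=
        depthAgainst_prodS_le (gateWDepths prodWeight Ψ) Pd hDlen.symm hPd_len hPd_le
      have hGD : gateWDepths prodWeight (Ψ ++ (P ++ [prodS w n out₀ us Ψ.length m])) =
          gateWDepths prodWeight Ψ ++ (Pd ++ [Gate.depthAgainst prodWeight
            (gateWDepths prodWeight Ψ ++ Pd) (prodS w n out₀ us Ψ.length m)]) := by
        rw [← List.append_assoc, gateWDepths_append_singleton, hGD1, List.append_assoc]
        rfl
      refine ⟨?_, ?_, ?_⟩
      · -- homogeneity
        intro g hg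
        rw [hGV, List.mem_append, List.mem_append, List.mem_singleton] at hg
        rcases hg with hg | hg | hg
        · exact ihhom g hg
        · exact ⟨m, hPv_hom g hg⟩
        · exact ⟨m, hg ▸ weightedHomogeneousComponent_isWeightedHomogeneous m _⟩
      · -- depth entries
        intro x hx
        rw [hGD, List.mem_append, List.mem_append, List.mem_singleton] at hx
        rcases hx with hx | hx | hx
        · exact ihdep x hx
        · exact Or.inr (hPd_le x hx)
        · exact Or.inr (hx ▸ hSd)
      · -- the collecting gates
        intro e he
        rcases Nat.lt_succ_iff_lt_or_eq.mp he with he' | rfl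
        · obtain ⟨hidx, hval, hdep⟩ := ihout e he'
          refine ⟨?_, ?_, ?_⟩
          · rw [List.length_append]; omega
          · rw [hGV, List.getD_append _ _ _ _ (by rw [hVlen]; exact hidx), hval]
          · rw [hGD, List.getD_append _ _ _ _ (by rw [hDlen]; exact hidx)]; exact hdep
        · have hout_eq : prodOut w n out₀ us Ψ₀ e = Ψ.length + P.length := by
            rw [prodOut, ← hΨ, ← hP]
          refine ⟨?_, ?_, ?_⟩
          · rw [hout_eq, List.length_append, List.length_append, List.length_singleton]; omega
          · rw [hGV, hout_eq, ← List.append_assoc]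
            exact getD_append_at_length _ _ _ (by
              rw [List.length_append, hVlen, hPv_len])
          · rw [hGD, hout_eq, ← List.append_assoc]
            rw [getD_append_at_length _ _ _ (by rw [List.length_append, hDlen, hPd_len])]
            exact hSd

end ProdSpec

/-! ### The theorem: bounded-fan-in blocks homogenise at the SAME product depth -/

/-- **Relative homogenisation at slope 1 for bounded product fan-in (Strassen's expansion).**
For any gate list `Φ` (a block, over weighted variables `w`) whose PRODUCT gates have fan-in
`≤ F`, and any truncation `d`, there is a gate list `Ψ` of length
`≤ |Φ| · (d + 1) · ((F + 1) ^ d + 1)`, every gate value of which is weighted homogeneous, every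
`prodWeight`-depth entry of which is dominated by one of `Φ` (so the product depth does NOT
grow), with operands `out i e` reading off the weight-`e` component (`e ≤ d`) of the value of
every gate `i` of `Φ`, at depth at most the depth of gate `i`.  This is the `HomRel k k`
conclusion under a fan-in hypothesis, with `2 ^ (a d²)` replaced by `(F + 1) ^ d`: the content
of `HomRel k j` / `HomSubReach` beyond this theorem is exactly product gates of fan-in `≥ 2 ^ d`.
[cite: Strassen1973, §3] [cite: Raz2013, §2] [cite: LimayeSrinivasanTavenas2025, Lemma 11, Lemma 19] -/
theorem exists_hom_block_of_fanIn (F : ℕ) (w : τ → ℕ) (d : ℕ) :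
    ∀ (Φ : List (Gate k τ)), (∀ us : List (Operand k τ), Gate.prod us ∈ Φ → us.length ≤ F) →
    ∃ (Ψ : List (Gate k τ)) (out : ℕ → ℕ → Operand k τ),
      (∀ g ∈ gateValues Ψ, ∃ e : ℕ, IsWeightedHomogeneous w g e) ∧
      Ψ.length ≤ Φ.length * ((d + 1) * ((F + 1) ^ d + 1)) ∧
      (∀ x ∈ gateWDepths prodWeight Ψ, ∃ y ∈ gateWDepths prodWeight Φ, x ≤ y) ∧
      ∀ i e : ℕ, i < Φ.length → e ≤ d →
        (out i e).RefsBelow Ψ.length ∧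
        (out i e).eval (gateValues Ψ) =
          weightedHomogeneousComponent w e ((gateValues Φ).getD i 0) ∧
        (out i e).depthIn (gateWDepths prodWeight Ψ) ≤ (gateWDepths prodWeight Φ).getD i 0 := by
  intro Φ
  induction Φ using List.reverseRecOn with
  | nil =>
      intro _
      exact ⟨[], fun _ _ => Operand.const 0, by simp [gateValues], by simp, by simp [gateWDepths],
        fun i e hi => absurd hi (Nat.not_lt_zero i)⟩
  | append_singleton gs g ih =>
      intro hF
      obtain ⟨Ψ₀, out₀, hhom, hlen, hdom, hout⟩ :=
        ih (fun us hus => hF us (List.mem_append_left _ hus))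
      have hM : d + 1 ≤ (d + 1) * ((F + 1) ^ d + 1) := Nat.le_mul_of_pos_right _ (Nat.succ_pos _)
      -- data of the old block
      have hvals : (gateValues gs).length = gs.length := gateValues_length gs
      have hds : (gateWDepths prodWeight gs).length = gs.length := gateWDepths_length prodWeight gs
      have hV₀len : (gateValues Ψ₀).length = Ψ₀.length := gateValues_length Ψ₀
      have hD₀len : (gateWDepths prodWeight Ψ₀).length = Ψ₀.length :=
        gateWDepths_length prodWeight Ψ₀
      have hrefs : ∀ j e, j < gs.length → e ≤ d → (out₀ j e).RefsBelow Ψ₀.length :=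
        fun j e hj he => (hout j e hj he).1
      have hev : ∀ j e, j < gs.length → e ≤ d →
          (out₀ j e).eval (gateValues Ψ₀) =
            weightedHomogeneousComponent w e ((gateValues gs).getD j 0) :=
        fun j e hj he => (hout j e hj he).2.1
      have hdp : ∀ j e, j < gs.length → e ≤ d →
          (out₀ j e).depthIn (gateWDepths prodWeight Ψ₀) ≤ (gateWDepths prodWeight gs).getD j 0 :=
        fun j e hj he => (hout j e hj he).2.2
      -- the new block's value / depth lists
      have hGVΦ : gateValues (gs ++ [g]) = gateValues gs ++ [g.eval (gateValues gs)] :=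
        gateValues_append_singleton gs g
      have hGDΦ : gateWDepths prodWeight (gs ++ [g]) =
          gateWDepths prodWeight gs ++ [Gate.depthAgainst prodWeight (gateWDepths prodWeight gs) g] :=
        gateWDepths_append_singleton prodWeight gs g
      -- generic assembly from a one-step extension
      have assemble : ∀ (Ψ₁ : List (Gate k τ)) (o : ℕ → Operand k τ),
          (∃ Y, Ψ₁ = Ψ₀ ++ Y) →
          (∀ g' ∈ gateValues Ψ₁, ∃ e : ℕ, IsWeightedHomogeneous w g' e) →
          Ψ₁.length ≤ Ψ₀.length + (d + 1) * ((F + 1) ^ d + 1) →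
          (∀ x ∈ gateWDepths prodWeight Ψ₁, x ∈ gateWDepths prodWeight Ψ₀ ∨
            x ≤ Gate.depthAgainst prodWeight (gateWDepths prodWeight gs) g) →
          (∀ e ≤ d, (o e).RefsBelow Ψ₁.length ∧
            (o e).eval (gateValues Ψ₁) = weightedHomogeneousComponent w e (g.eval (gateValues gs)) ∧
            (o e).depthIn (gateWDepths prodWeight Ψ₁) ≤
              Gate.depthAgainst prodWeight (gateWDepths prodWeight gs) g) →
          ∃ (Ψ : List (Gate k τ)) (out : ℕ → ℕ → Operand k τ),
            (∀ g ∈ gateValues Ψ, ∃ e : ℕ, IsWeightedHomogeneous w g e) ∧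
            Ψ.length ≤ (gs ++ [g]).length * ((d + 1) * ((F + 1) ^ d + 1)) ∧
            (∀ x ∈ gateWDepths prodWeight Ψ, ∃ y ∈ gateWDepths prodWeight (gs ++ [g]), x ≤ y) ∧
            ∀ i e : ℕ, i < (gs ++ [g]).length → e ≤ d →
              (out i e).RefsBelow Ψ.length ∧
              (out i e).eval (gateValues Ψ) =
                weightedHomogeneousComponent w e ((gateValues (gs ++ [g])).getD i 0) ∧
              (out i e).depthIn (gateWDepths prodWeight Ψ) ≤
                (gateWDepths prodWeight (gs ++ [g])).getD i 0 := by
        intro Ψ₁ o hY hhom₁ hlen₁ hdep₁ ho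
        obtain ⟨Y, hY⟩ := hY
        obtain ⟨XV, hXV, -⟩ := gateValues_prefix Ψ₀ Y
        obtain ⟨XD, hXD, -⟩ := gateWDepths_prefix prodWeight Ψ₀ Y
        have hV₁ : gateValues Ψ₁ = gateValues Ψ₀ ++ XV := by rw [hY, hXV]
        have hD₁ : gateWDepths prodWeight Ψ₁ = gateWDepths prodWeight Ψ₀ ++ XD := by rw [hY, hXD]
        have hlen01 : Ψ₀.length ≤ Ψ₁.length := by rw [hY, List.length_append]; omega
        refine ⟨Ψ₁, fun i e => if i < gs.length then out₀ i e else o e, hhom₁, ?_, ?_, ?_⟩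
        · rw [List.length_append, List.length_singleton, Nat.succ_mul]
          exact hlen₁.trans (Nat.add_le_add_right hlen _)
        · intro x hx
          rcases hdep₁ x hx with hx' | hx'
          · obtain ⟨y, hy, hxy⟩ := hdom x hx'
            exact ⟨y, by rw [hGDΦ]; exact List.mem_append_left _ hy, hxy⟩
          · exact ⟨_, by rw [hGDΦ]; exact List.mem_append_right _ (List.mem_singleton_self _), hx'⟩
        · intro i e hi he
          rw [List.length_append, List.length_singleton] at hi
          by_cases hi' : i < gs.length
          · simp only [hi', if_true]
            obtain ⟨hr, hv, hdpt⟩ := hout i e hi' he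
            refine ⟨Operand.refsBelow_mono hlen01 hr, ?_, ?_⟩
            · rw [hV₁, operand_eval_append_of_refsBelow _ _ (hV₀len ▸ hr), hv, hGVΦ,
                List.getD_append _ _ _ _ (by rw [hvals]; exact hi')]
            · rw [hD₁, depthIn_append_of_refsBelow _ _ (hD₀len ▸ hr), hGDΦ,
                List.getD_append _ _ _ _ (by rw [hds]; exact hi')]
              exact hdpt
          · have hin : i = gs.length := by omega
            subst hin
            simp only [lt_irrefl, if_false]
            obtain ⟨hr, hv, hdpt⟩ := ho e he
            refine ⟨hr, ?_, ?_⟩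
            · rw [hv, hGVΦ, getD_append_at_length _ _ _ hvals.symm]
            · rw [hGDΦ, getD_append_at_length _ _ _ hds.symm]; exact hdpt
      -- the one-step extension, by cases on the new gate
      cases g with
      | sum args =>
          refine assemble (Ψ₀ ++ sumBlock w gs.length d out₀ args)
            (fun e => Operand.gate (Ψ₀.length + e)) ⟨_, rfl⟩ ?_ ?_ ?_ ?_
          · -- homogeneity
            intro g' hg'
            rw [gateValues_layer Ψ₀ _ (sumBlock_argsBelow w gs.length d out₀ args hrefs),
              List.mem_append] at hg'
            rcases hg' with hg' | hg'
            · exact hhom g' hg'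
            · rw [List.mem_map] at hg'
              obtain ⟨G, hG, rfl⟩ := hg'
              simp only [sumBlock, List.mem_map, List.mem_range] at hG
              obtain ⟨e, he, rfl⟩ := hG
              rw [eval_sumBlock_gate w gs.length d out₀ args (gateValues Ψ₀) (gateValues gs) hvals hev
                (by omega)]
              exact ⟨e, weightedHomogeneousComponent_isWeightedHomogeneous e _⟩
          · rw [List.length_append, length_sumBlock]; omega
          · intro x hx
            rw [gateWDepths_append_block prodWeight Ψ₀ _
              (sumBlock_argsBelow w gs.length d out₀ args hrefs), List.mem_append] at hx
            rcases hx with hx | hx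
            · exact Or.inl hx
            · right
              rw [List.mem_map] at hx
              obtain ⟨G, hG, rfl⟩ := hx
              simp only [sumBlock, List.mem_map, List.mem_range] at hG
              obtain ⟨e, he, rfl⟩ := hG
              exact depthAgainst_sumBlock_le w gs.length d out₀ args _ _ hdp (by omega)
          · intro e he
            have hGV := gateValues_layer Ψ₀ _ (sumBlock_argsBelow w gs.length d out₀ args hrefs)
            have hGD := gateWDepths_append_block prodWeight Ψ₀ _
              (sumBlock_argsBelow w gs.length d out₀ args hrefs)
            have helt : e < (sumBlock w gs.length d out₀ args).length := by
              rw [length_sumBlock]; omega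
            refine ⟨?_, ?_, ?_⟩
            · show Ψ₀.length + e < (Ψ₀ ++ sumBlock w gs.length d out₀ args).length
              rw [List.length_append]; omega
            · rw [Operand.eval_gate, hGV, ← hV₀len, getD_append_length_add,
                List.getD_eq_getElem _ _ (by rw [List.length_map]; exact helt), List.getElem_map]
              simp only [sumBlock, List.getElem_map, List.getElem_range]
              exact eval_sumBlock_gate w gs.length d out₀ args (gateValues Ψ₀) (gateValues gs) hvals
                hev he
            · rw [Operand.depthIn, hGD, ← hD₀len, getD_append_length_add,
                List.getD_eq_getElem _ _ (by rw [List.length_map]; exact helt), List.getElem_map]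
              simp only [sumBlock, List.getElem_map, List.getElem_range]
              exact depthAgainst_sumBlock_le w gs.length d out₀ args _ _ hdp he
      | prod us =>
          have hFus : us.length ≤ F := hF us (List.mem_append_right _ (List.mem_singleton_self _))
          obtain ⟨hhom₁, hdep₁, hout₁⟩ := prodBlocks_spec (us := us) Ψ₀ (gateValues gs)
            (gateWDepths prodWeight gs) hvals hhom hrefs hev hdp (d + 1) le_rfl
          refine assemble (prodBlocks w gs.length out₀ us Ψ₀ (d + 1))
            (fun e => Operand.gate (prodOut w gs.length out₀ us Ψ₀ e))
            (prodBlocks_prefix w gs.length out₀ us Ψ₀ (d + 1)) hhom₁ ?_ hdep₁ ?_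
          · exact length_prodBlocks_le (d := d) hFus Ψ₀ (d + 1) le_rfl
          · intro e he
            obtain ⟨hidx, hval, hdpt⟩ := hout₁ e (by omega)
            exact ⟨hidx, by rw [Operand.eval_gate, hval], by rw [Operand.depthIn]; exact hdpt⟩

/-- **Corollary (the `HomRel k k`-shaped statement under a fan-in bound).**  Blocks of relative
product-depth `≤ kk` whose product gates have fan-in `≤ F` have an every-gate-weighted-homogeneous
version of relative product-depth `≤ kk` (slope 1, no additive constant) and size
`≤ |Φ| · (d + 1) · ((F + 1) ^ d + 1)`, outputting all weighted components up to `d` of all gates.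
With `F + 1 ≤ 2 ^ d` the size is `≤ |Φ| · (d + 1) · (2 ^ (d * d) + 1)`: inside the `HomRel`
budget.  [cite: Strassen1973, §3] [cite: Raz2013, §2] [cite: LimayeSrinivasanTavenas2025, Lemma 11] -/
theorem homRel_shape_of_fanIn (kk F : ℕ) (w : τ → ℕ) (d : ℕ) (Φ : List (Gate k τ))
    (hF : ∀ us : List (Operand k τ), Gate.prod us ∈ Φ → us.length ≤ F)
    (hk : ∀ y ∈ gateWDepths prodWeight Φ, y ≤ kk) :
    ∃ (Ψ : List (Gate k τ)) (out : ℕ → ℕ → Operand k τ),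
      (∀ g ∈ gateValues Ψ, ∃ e : ℕ, IsWeightedHomogeneous w g e) ∧
      (∀ x ∈ gateWDepths prodWeight Ψ, x ≤ kk) ∧
      Ψ.length ≤ Φ.length * ((d + 1) * ((F + 1) ^ d + 1)) ∧
      ∀ i e : ℕ, i < Φ.length → e ≤ d →
        (out i e).RefsBelow Ψ.length ∧
        (out i e).eval (gateValues Ψ) =
          weightedHomogeneousComponent w e ((gateValues Φ).getD i 0) := by
  obtain ⟨Ψ, out, hhom, hlen, hdom, hout⟩ := exists_hom_block_of_fanIn F w d Φ hF
  refine ⟨Ψ, out, hhom, fun x hx => ?_, hlen, fun i e hi he => ⟨(hout i e hi he).1, (hout i e hi he).2.1⟩⟩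
  obtain ⟨y, hy, hxy⟩ := hdom x hx
  exact hxy.trans (hk y hy)

/-- The size budget for fan-in `< 2 ^ d`: `(F + 1) ^ d ≤ 2 ^ (d * d)`. -/
theorem pow_fanIn_le (F d : ℕ) (hF : F + 1 ≤ 2 ^ d) : (F + 1) ^ d ≤ 2 ^ (d * d) := by
  rw [pow_mul]
  exact Nat.pow_le_pow_left hF d

end Summit.ValiantsHypothesis.ValiantsHypothesis.Theorems.DepthWindow
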